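import Summits.ResolutionOfSingularities.ResolutionOfSingularities.Theorems.MarkedTransferCampaignW46PlaneProcrastinationHolds
import HarnessLib

/-!
# [OURS · L1 W4.6 rung (i-d)] THE Eq. (127)/(128)-ROLE ON SURFACES WITH OUR PER-POINT INVARIANT `ι = (μ, ord)` — statement
# and proof (cell res-hironaka, LADDER-RESOLUTION rung L, D-0089; campaign s46, prover res-L1-s46-pv-1; host route
# MarkedTransfer, `--supports stmt-ResolutionOfSingularities-16155`)

HONEST FRAMING. Nothing here is a statement of H. Hironaka's manuscript (2017-03-23, [Hironaka2017]) and nothing here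
asserts that any statement of it holds. The invariant below is OURS (Zariski's loose exit count of the normal form, this
campaign's `looseGermMeasure`, paired with the order), NOT the manuscript's `Inv`-string; the theorem replaces the ROLE that
Th. 16.6 (2)/(3) (Eqs. (127)/(128), p.84 l.10–28) play in the termination argument, on surfaces, for §2.1-permissible steps
that do not procrastinate. The typed candidate carriers enter only as posited résumés (typed corollary at the end, every
notion instance whose résumés isolate no stray point). AI-written; weaker than expert review. No `sorry`; axioms standard.

## The invariant and the rung

* `pointInvariant A E y := (μ(A, E, y), ord_y J) ∈ ℕ ×ₗ ℕ∞` — OUR per-point resolution invariant of a state `(Z, E = (J, b))`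
  at a point `y`: the loose germ measure `μ` (`looseGermMeasure (𝒪_{Z,y}) J_y b`, p521109) and the order `ord_y J`
  (`Resolution.idealOrder`), compared LEXICOGRAPHICALLY in the well-founded `ℕ ×ₗ ℕ∞` (`wellFoundedLT_pointInvariant`).
* `CentreProcrastinates E D` — the centre `D` procrastinates for `E`: `D = {ξ}` is one closed point lying on a curve of
  `Sing(E)` (verbatim the body of `PermissibleRun.Procrastinates`, p515754; `PermissibleRun.procrastinates_iff`).
* `PlaneInvariantDecreases p K` — **RUNG (i-d)**, résumé-free: for every standard ideal exponent `E` on an ambient scheme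
  `Z` of dimension `≤ 2`, every §2.1-permissible centre `D` for `E` that does not procrastinate, and every blowing up
  `π : Z′ → Z` along `D` with transform `E′` (Def. 2.1): **(127)-role** `ι(A′, E′, y′) <_lex ι(A, E, π y′)` at EVERY point
  `y′` over the centre, and **(128)-role / naturality** `ι(A′, E′, y′) = ι(A, E, π y′)` at every point off the centre.
* `planeInvariantDecreases_holds : PlaneInvariantDecreases p K` for every field `K : Type` of characteristic `p` — PROVED.
  Laws used: off the centre the germ of the transform is the germ downstairs (`transform_germ_eq_off_centre`, pv-9); at a
  point step on a surface the measures over the centre sum to less than `μ(ξ)` (`looseGermMeasure_centre_lt`, gen 3 of this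
  seat); at a divisorial step (centre of codimension one: a regular curve of a surface, or a point of a curve) the blow-up
  is an isomorphism matching `μ` (`looseGermMeasure_curveStep_eq`) and `J_y = ρ^b · J′_{y′}` forces
  `ord_{y′} J′ + b ≤ ord_y J` (`idealOrder_transform_add_le_of_divisorialCentre`).
* typed corollary `StepNabla.pointInvariant_laws`: for EVERY notion instance `N` and reading `Rd` whose résumés isolate no
  stray point (`Resumes.NoStrayPoint N Rd`, p515754), at every ∇-step of the typed Th. 16.6 procedure from a surface state,
  OUR invariant obeys the (127)-role over the centre and the (128)-role off it. DIFFERENCES FROM THE PRINTED SHAPE, stated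
  plainly: the manuscript's (127) is asserted at the CLOSED points over `D` OFF `D′ = ∇′ ∩ π⁻¹(D)` and its (128) (equality)
  at the points of `D′`; ours drops strictly at ALL points over `D` (no exceptional sub-locus) and is unchanged off
  `π⁻¹(D)`. WHY THE NON-PROCRASTINATION HYPOTHESIS: at a procrastinating step no state function whatsoever can drop
  along all permissible steps on surfaces (infinite procrastinating sequences exist, p473754/p475556; rung (i-c)).

## References

* O. Zariski, P. Samuel, Commutative Algebra II (1960), Appendix 5. [ZariskiSamuel1960] Companion modules:
  `…PlaneProcrastinationCentre` (p525273), `…Curve` (p522351), `…Holds` (p526033), `…FiniteExitBoundGlue` (pv-9).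
* H. Hironaka, ms. 2017-03-23, Th. 16.6 (2)/(3) p.84 l.10–28 — the ROLE replaced only, not cited as fact. [Hironaka2017]
-/

noncomputable section

set_option linter.dupNamespace false -- mandated namespace of this single-conjunct summit

open CategoryTheory AlgebraicGeometry TopologicalSpace IsLocalRing

namespace Summit.ResolutionOfSingularities.ResolutionOfSingularities.Theorems

namespace CampaignW46

open Literature.AlgebraicGeometry.Resolution
open Literature.AlgebraicGeometry.Hironaka2017.S02Preliminaries
open Literature.AlgebraicGeometry.Hironaka2017.Datum
open Scheme.IdealSheafData

universe u

/-! ## Germ-level order bookkeeping (any commutative local rings) -/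

section Germ

/-- An isomorphism of local rings identifies the `𝔪`-adic filtrations: `e(I) ⊆ 𝔪_S^n ↔ I ⊆ 𝔪_R^n`. [folklore] -/
theorem map_le_maximalIdeal_pow_iff {R S : Type*} [CommRing R] [CommRing S] [IsLocalRing R] [IsLocalRing S]
    (e : R ≃+* S) (I : Ideal R) (n : ℕ) : I.map e ≤ maximalIdeal S ^ n ↔ I ≤ maximalIdeal R ^ n := by
  constructor
  · intro h
    rw [Ideal.map_le_iff_le_comap, ← Ideal.map_symm, Ideal.map_pow, map_ringEquiv_maximalIdeal] at h
    exact h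
  · intro h
    calc I.map e ≤ (maximalIdeal R ^ n).map e := Ideal.map_mono h
      _ = maximalIdeal S ^ n := by rw [Ideal.map_pow, map_ringEquiv_maximalIdeal]

/-- `J ⊆ (ρ^b)` implies `J ⊆ (ρ^b) · (J : ρ^b)`. [folklore] -/
theorem le_span_pow_mul_colon {R : Type*} [CommRing R] (J : Ideal R) (ρ : R) (b : ℕ)
    (hJ : J ≤ Ideal.span {ρ ^ b}) : J ≤ Ideal.span {ρ ^ b} * (Submodule.colon J (Ideal.span {ρ ^ b}) : Ideal R) := by
  intro f hf
  obtain ⟨g, rfl⟩ := Ideal.mem_span_singleton'.mp (hJ hf)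
  have hg : g ∈ (Submodule.colon J (Ideal.span {ρ ^ b}) : Ideal R) := by
    refine Submodule.mem_colon.mpr fun r hr => ?_
    obtain ⟨s, rfl⟩ := Ideal.mem_span_singleton'.mp hr
    rw [smul_eq_mul, show g * (s * ρ ^ b) = s * (g * ρ ^ b) by ring]
    exact J.mul_mem_left s hf
  rw [show g * ρ ^ b = ρ ^ b * g from mul_comm _ _]
  exact Ideal.mul_mem_mul (Ideal.mem_span_singleton_self _) hg

/-- `ℕ∞` bookkeeping: if `n ≤ a` forces `n + b ≤ c` for every natural `n`, then `a + b ≤ c`. [folklore] -/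
theorem ENat.add_natCast_le_of_forall {a c : ℕ∞} {b : ℕ} (h : ∀ n : ℕ, (n : ℕ∞) ≤ a → ((n + b : ℕ) : ℕ∞) ≤ c) :
    a + b ≤ c := by
  induction a using ENat.recTopCoe with
  | top =>
    have hc : (⊤ : ℕ∞) ≤ c := ENat.forall_natCast_le_iff_le.mp fun m _ =>
      le_trans (by exact_mod_cast Nat.le_add_right m b) (h m le_top)
    rw [top_le_iff.mp hc]
    exact le_top
  | coe k => exact_mod_cast h k le_rfl

end Germ

/-! ## The order of an ideal sheaf under identification of germs -/

section Order

/-- If a ring isomorphism of stalks carries `I_x` onto `J_y` then `ord_y J = ord_x I`. [folklore] -/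
theorem idealOrder_eq_of_stalkIdeal_map_ringEquiv {X Y : Scheme.{u}} {I : X.IdealSheafData} {J : Y.IdealSheafData}
    {x : X} {y : Y} (e : X.presheaf.stalk x ≃+* Y.presheaf.stalk y) (he : (stalkIdeal I x).map e = stalkIdeal J y) :
    idealOrder J y = idealOrder I x := by
  refine le_antisymm (ENat.forall_natCast_le_iff_le.mp fun n hn => ?_)
    (ENat.forall_natCast_le_iff_le.mp fun n hn => ?_)
  · rw [le_idealOrder_iff] at hn ⊢
    rw [← he] at hn
    exact (map_le_maximalIdeal_pow_iff e _ n).mp hn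
  · rw [le_idealOrder_iff] at hn ⊢
    rw [← he]
    exact (map_le_maximalIdeal_pow_iff e _ n).mpr hn

/-- **Off the centre the order does not change**: for a blowing up `π` along the reduced ideal of a closed `D` and `y′`
with `π y′ ∉ D`, `ord_{y′} J′ = ord_{π y′} J` (`J′` the controlled transform with any exponent). [folklore] -/
theorem idealOrder_transform_of_not_mem {Z Z' : Scheme.{u}} {π : Z' ⟶ Z} {D : Closeds Z}
    (hπ : IsBlowup π (vanishingIdeal D)) (E : IdealExponent Z) {y' : Z'} (hy' : π y' ∉ (D : Set Z)) :
    idealOrder (E.transform π D).J y' = idealOrder E.J (π y') := by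
  obtain ⟨e, he, -⟩ := transform_germ_eq_off_centre hπ E hy'
  exact idealOrder_eq_of_stalkIdeal_map_ringEquiv e he

end Order

/-! ## OUR per-point invariant and the rung statement -/

section Defs

variable {p : ℕ} [Fact p.Prime] {K : Type u} [Field K] [CharP K p]

/-- [OURS · L1 W4.6 rung (i-d)] NOT a statement of the manuscript. **OUR per-point resolution invariant** of the state
`(Z, E = (J, b))` at the point `y`: the pair (loose germ measure `μ(A, E, y) = ν̃(𝒪_{Z,y}, NF_b(J_y), b)`, order `ord_y J`)
in the lexicographic product `ℕ ×ₗ ℕ∞`. Replaces the role of the `Inv`-string `(Inv_ξ(𝒴(0)), …)` of Eq. (127) p.84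
l.11–16 as the quantity whose strict decrease drives termination ON SURFACES; it is not that string and says nothing
about it. [folklore] -/
def pointInvariant (A : AmbientDatum p K) (E : IdealExponent A.Z) (y : A.Z) : ℕ ×ₗ ℕ∞ :=
  toLex (looseGermMeasure (A.Z.presheaf.stalk y) (stalkIdeal E.J y) E.b, idealOrder E.J y)

/-- The value order of OUR invariant is well founded (lexicographic product of two well-orders). [folklore] -/
theorem wellFoundedLT_pointInvariant : WellFoundedLT (ℕ ×ₗ ℕ∞) := inferInstance

/-- [OURS · L1 W4.6 rung (i-d)] NOT a statement of the manuscript. **The centre `D` PROCRASTINATES for `E`**: `D` is a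
single point `ξ` lying on a curve of the singular locus (some `η ∈ Sing(E)`, `η ≠ ξ`, specialises to `ξ`) — verbatim
the body of `PermissibleRun.Procrastinates` (p515754), as a predicate on one step. [folklore] -/
def CentreProcrastinates {Z : Scheme.{u}} (E : IdealExponent Z) (D : Closeds Z) : Prop :=
  ∃ ξ η : Z, (D : Set Z) = {ξ} ∧ η ∈ E.sing ∧ η ≠ ξ ∧ η ⤳ ξ

/-- Step `k` of a permissible sequence procrastinates iff its centre procrastinates for its ideal exponent
(definitional). [folklore] -/
theorem PermissibleRun.procrastinates_iff (r : PermissibleRun p K) (k : ℕ) :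
    r.Procrastinates k ↔ CentreProcrastinates (r.E k) (r.D k) :=
  Iff.rfl

/-- [OURS · L1 W4.6 rung (i-d)] NOT a statement of the manuscript. **RUNG (i-d): THE Eq. (127)/(128)-ROLE ON SURFACES
WITH OUR INVARIANT** — replaces the role of Th. 16.6 (2) (Eq. (127): strict lexicographic decrease over the centre)
and (3) (Eq. (128): no change elsewhere), p.84 l.10–28, for the résumé-free §2.1-permissible steps on surfaces that do
not procrastinate: for every standard ideal exponent `E` on an ambient scheme `Z` with `topologicalKrullDim Z ≤ 2`,
every permissible centre `D` for `E` (§2.1) with `¬ CentreProcrastinates E D`, every blowing up `π : Z′ → Z` along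
(the reduced ideal of) `D` onto an ambient scheme `Z′`, and the transform `E′` (Def. 2.1):
`ι(A′, E′, y′) <_lex ι(A, E, π y′)` for every `y′` with `π y′ ∈ D`, and `ι(A′, E′, y′) = ι(A, E, π y′)` for every `y′`
with `π y′ ∉ D`. [folklore] -/
def PlaneInvariantDecreases (p : ℕ) [Fact p.Prime] (K : Type u) [Field K] [CharP K p] : Prop :=
  ∀ (A A' : AmbientDatum p K) (E : IdealExponent A.Z), E.IsStandard → Regime.dimLE 2 A E →
    ∀ (D : Closeds A.Z), E.IsPermissibleCentre A.hom D → ¬ CentreProcrastinates E D →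
      ∀ (π : A'.Z ⟶ A.Z), IsBlowup π (vanishingIdeal D) →
        (∀ y' : A'.Z, π y' ∈ (D : Set A.Z) → pointInvariant A' (E.transform π D) y' < pointInvariant A E (π y')) ∧
        (∀ y' : A'.Z, π y' ∉ (D : Set A.Z) → pointInvariant A' (E.transform π D) y' = pointInvariant A E (π y'))

end Defs

/-! ## The laws (universe-polymorphic part) -/

section LawsU

variable {p : ℕ} [Fact p.Prime] {K : Type u} [Field K] [CharP K p]

/-- **(128)-role / naturality off the centre.** Along any blowing up of a closed centre, at a point NOT over the centre
OUR invariant is unchanged (both components are germ-local). [folklore] -/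
theorem pointInvariant_eq_of_not_mem {A A' : AmbientDatum p K} (E : IdealExponent A.Z) {D : Closeds A.Z}
    {π : A'.Z ⟶ A.Z} (hπ : IsBlowup π (vanishingIdeal D)) {y' : A'.Z} (hy' : π y' ∉ (D : Set A.Z)) :
    pointInvariant A' (E.transform π D) y' = pointInvariant A E (π y') := by
  obtain ⟨e, he, hb⟩ := transform_germ_eq_off_centre hπ E hy'
  unfold pointInvariant
  rw [← he, hb, looseGermMeasure_map_ringEquiv, idealOrder_eq_of_stalkIdeal_map_ringEquiv e he]

/-- **The order law of a divisorial step.** Let `D` be a permissible centre for `E` whose generic point `η` has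
codimension one (a regular curve of a surface, or a closed point of a curve), `π` the blowing up along `D` (an
isomorphism) and `E′` the transform. At every `y′` over the centre `ord_{y′} J′ + b ≤ ord_{π y′} J`: with `ρ` a local
equation of `D` at `y = π y′` one has `J_y ⊆ (ρ^b)` (permissibility) and `J′_{y′} ≅ (J_y : ρ^b)`, so
`J_y ⊆ ρ^b · (J_y : ρ^b) ⊆ 𝔪^{b + ord J′}`. [folklore] -/
theorem idealOrder_transform_add_le_of_divisorialCentre (A A' : AmbientDatum p K) (E : IdealExponent A.Z)
    {D : Closeds A.Z} (hD : E.IsPermissibleCentre A.hom D) {η : A.Z} (hη : IsGenericPoint η (D : Set A.Z))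
    (hcoh : Order.coheight η = 1) {π : A'.Z ⟶ A.Z} (hπ : IsBlowup π (vanishingIdeal D)) {y' : A'.Z}
    (hy : π y' ∈ (D : Set A.Z)) :
    idealOrder (E.transform π D).J y' + E.b ≤ idealOrder E.J (π y') := by
  haveI := ambient_isIntegral A
  haveI : IsLocallyNoetherian A.Z := ambient_isLocallyNoetherian A
  haveI : IsIso π := isIso_of_curveCentre A A' hη hcoh hπ
  set y := π y' with hydef
  -- the stalk isomorphism and the transported colon
  let e : A.Z.presheaf.stalk y ≃+* A'.Z.presheaf.stalk y' := (asIso (π.stalkMap y')).commRingCatIsoToRingEquiv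
  have he : e.toRingHom = (π.stalkMap y').hom := rfl
  have hJ' : stalkIdeal (E.transform π D).J y' =
      (Submodule.colon (stalkIdeal E.J y) (stalkIdeal (vanishingIdeal D) y ^ E.b : Ideal (A.Z.presheaf.stalk y))).map e := by
    show stalkIdeal (controlledTransform π (vanishingIdeal D) E.J E.b) y' = _
    rw [hπ.stalkIdeal_controlledTransform E.J E.b y', stalkIdeal_comap_eq_map_stalkMap,
      stalkIdeal_comap_eq_map_stalkMap, ← Ideal.map_pow, ← he]
    exact (map_colon_eq_of_ringEquiv e _ _).symm
  -- a local equation `ρ` of `D` at `y`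
  have hsp : η ⤳ y := hη.specializes hy
  obtain ⟨ρ, hρ, hIρ⟩ := exists_stalkIdeal_primeDivisorIdeal_eq_span
    (ambient_isRegular A).uniqueFactorizationMonoid_stalk hsp hcoh
  rw [← vanishingIdeal_eq_primeDivisorIdeal hη] at hIρ
  have hρm : ρ ∈ maximalIdeal (A.Z.presheaf.stalk y) := by
    have hyD : y ∈ (vanishingIdeal D).support := by
      rw [← SetLike.mem_coe, coe_support_vanishingIdeal]; exact hy
    have hle := (mem_support_iff_stalkIdeal_le (vanishingIdeal D) y).mp hyD
    rw [hIρ] at hle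
    exact hle (Ideal.mem_span_singleton_self ρ)
  -- `J_y ⊆ (ρ^b)` by permissibility
  have hregD : Scheme.IsRegular (vanishingIdeal D).subscheme := by
    haveI := hD.smooth
    exact fun z => isRegularLocalRing_stalk_of_smooth_of_field ((vanishingIdeal D).subschemeι ≫ A.hom) z
  have hJle : stalkIdeal E.J y ≤ Ideal.span {ρ ^ E.b} := by
    have hglob : E.J ≤ vanishingIdeal D ^ E.b :=
      Literature.AlgebraicGeometry.Hironaka2017.le_vanishingIdeal_pow_of_forall_le_idealOrder (ambient_isRegular A)
        hregD (fun z hz => hD.subset_sing hz)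
    have h1 := stalkIdeal_mono hglob y
    rw [stalkIdeal_pow, hIρ, Ideal.span_singleton_pow] at h1
    exact h1
  rw [hIρ, Ideal.span_singleton_pow] at hJ'
  -- compare the filtrations
  refine ENat.add_natCast_le_of_forall fun n hn => ?_
  rw [le_idealOrder_iff] at hn ⊢
  rw [hJ', map_le_maximalIdeal_pow_iff] at hn
  calc stalkIdeal E.J y
      ≤ Ideal.span {ρ ^ E.b} * (Submodule.colon (stalkIdeal E.J y) (Ideal.span {ρ ^ E.b}) : Ideal _) :=
        le_span_pow_mul_colon _ ρ E.b hJle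
    _ ≤ maximalIdeal _ ^ E.b * maximalIdeal _ ^ n := Ideal.mul_mono
        ((Ideal.span_singleton_le_iff_mem _).mpr (Ideal.pow_mem_pow hρm E.b)) hn
    _ = maximalIdeal _ ^ (n + E.b) := by rw [← pow_add, add_comm]

/-- **Strict order drop at a divisorial step** (standard `E`: `b ≥ 1` and `ord_{π y′} J < ∞`). [folklore] -/
theorem idealOrder_transform_lt_of_divisorialCentre (A A' : AmbientDatum p K) (E : IdealExponent A.Z)
    (hE : E.IsStandard) {D : Closeds A.Z} (hD : E.IsPermissibleCentre A.hom D) {η : A.Z}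
    (hη : IsGenericPoint η (D : Set A.Z)) (hcoh : Order.coheight η = 1) {π : A'.Z ⟶ A.Z}
    (hπ : IsBlowup π (vanishingIdeal D)) {y' : A'.Z} (hy : π y' ∈ (D : Set A.Z)) :
    idealOrder (E.transform π D).J y' < idealOrder E.J (π y') := by
  haveI := ambient_isIntegral A
  haveI : IsLocallyNoetherian A.Z := ambient_isLocallyNoetherian A
  have hle := idealOrder_transform_add_le_of_divisorialCentre A A' E hD hη hcoh hπ hy
  obtain ⟨m, hm⟩ := exists_idealOrder_eq_natCast hE.1 (π y')
  rw [hm] at hle ⊢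
  have hfin : idealOrder (E.transform π D).J y' ≠ ⊤ := by
    intro ht
    rw [ht, top_add] at hle
    exact ENat.coe_ne_top m (top_le_iff.mp hle)
  obtain ⟨k, hk⟩ := ENat.ne_top_iff_exists.mp hfin
  rw [← hk] at hle ⊢
  have hkb : k + E.b ≤ m := by exact_mod_cast hle
  have hb := hE.2
  exact_mod_cast (show k < m by omega)

end LawsU

/-! ## The laws at `K : Type` and the rung -/

section Laws

variable {p : ℕ} [Fact p.Prime] {K : Type} [Field K] [CharP K p]

/-- **The measure law of a non-procrastinating point step on a surface, pointwise**: at every point over the centre `ξ`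
the loose germ measure is smaller than `μ(ξ)` (`looseGermMeasure_centre_lt` with a one-point finset). [folklore] -/
theorem looseGermMeasure_lt_of_pointCentre (A A' : AmbientDatum p K) (E : IdealExponent A.Z) {ξ : A.Z}
    (hξ : IsClosed ({ξ} : Set A.Z)) (hξS : ξ ∈ E.sing) (hnp : ∀ η ∈ E.sing, η ⤳ ξ → η = ξ)
    (hdim : ringKrullDim (A.Z.presheaf.stalk ξ) = 2) {π : A'.Z ⟶ A.Z}
    (hπ : IsBlowup π (vanishingIdeal ⟨{ξ}, hξ⟩)) {y' : A'.Z} (hy : π y' = ξ) :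
    looseGermMeasure (A'.Z.presheaf.stalk y') (stalkIdeal (E.transform π ⟨{ξ}, hξ⟩).J y') E.b <
      looseGermMeasure (A.Z.presheaf.stalk ξ) (stalkIdeal E.J ξ) E.b := by
  classical
  have h := looseGermMeasure_centre_lt A A' E ξ hξ π hξS hnp hdim hπ {y'} (by simpa using hy)
  simpa using h

/-- **A closed centre point of codimension `≠ 2` on a scheme of dimension `≤ 2` has codimension one** (it lies in
`Sing(E) ⊆ V(J)` for a standard `E`, so it is not the generic point). [folklore] -/
theorem coheight_eq_one_of_isClosed_of_ne_two (A : AmbientDatum p K) {E : IdealExponent A.Z} (hE : E.IsStandard)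
    (hdimZ : topologicalKrullDim A.Z ≤ 2) {η : A.Z} (hηS : η ∈ E.sing)
    (h2 : ringKrullDim (A.Z.presheaf.stalk η) ≠ 2) : Order.coheight η = 1 := by
  haveI := ambient_isIntegral A
  have hηsupp : η ∈ (E.J.support : Set A.Z) := sing_le_support E hE.2 hηS
  have hne0 : Order.coheight η ≠ 0 := by
    intro h0
    rw [eq_genericPoint_of_coheight_eq_zero h0] at hηsupp
    exact not_mem_support_genericPoint hE.1 hηsupp
  have hne2 : Order.coheight η ≠ 2 := by
    intro h; apply h2; rw [ringKrullDim_stalk_eq_coheight, h]; rfl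
  have h2' : ((Order.height η + Order.coheight η : ℕ∞) : WithBot ℕ∞) ≤ 2 :=
    (coe_height_add_coheight_le_topologicalKrullDim η).trans hdimZ
  have h3 : Order.height η + Order.coheight η ≤ 2 := WithBot.coe_le_coe.mp h2'
  have h4 : Order.coheight η ≤ 2 := le_add_self.trans h3
  have hfin : Order.coheight η ≠ ⊤ := by intro ht; rw [ht] at h4; simp at h4
  obtain ⟨c, hc⟩ := ENat.ne_top_iff_exists.mp hfin
  rw [← hc] at h4 hne0 hne2 ⊢
  have h5 : c ≤ 2 := by exact_mod_cast h4
  have h6 : c ≠ 0 := fun h => hne0 (by rw [h]; rfl)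
  have h7 : c ≠ 2 := fun h => hne2 (by rw [h]; rfl)
  have h8 : c = 1 := by omega
  rw [h8]; rfl

/-- **(127)-role over the centre.** For a standard `E` on an ambient scheme of dimension `≤ 2`, a permissible centre `D`
that does not procrastinate, the blowing up `π` along `D` and the transform `E′`: at every point `y′` over the centre
`ι(A′, E′, y′) <_lex ι(A, E, π y′)`. Point step on a surface: the measure drops (`looseGermMeasure_lt_of_pointCentre`);
divisorial step: the measure is unchanged (`looseGermMeasure_curveStep_eq`) and the order drops
(`idealOrder_transform_lt_of_divisorialCentre`). [folklore] -/
theorem pointInvariant_lt_of_mem (A A' : AmbientDatum p K) (E : IdealExponent A.Z) (hE : E.IsStandard)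
    (hdimZ : topologicalKrullDim A.Z ≤ 2) {D : Closeds A.Z} (hD : E.IsPermissibleCentre A.hom D)
    (hnp : ¬ CentreProcrastinates E D) {π : A'.Z ⟶ A.Z} (hπ : IsBlowup π (vanishingIdeal D)) {y' : A'.Z}
    (hy : π y' ∈ (D : Set A.Z)) :
    pointInvariant A' (E.transform π D) y' < pointInvariant A E (π y') := by
  -- the generic point of the centre
  obtain ⟨η, hη⟩ : ∃ η : A.Z, IsGenericPoint η (D : Set A.Z) :=
    ⟨_, hD.irreducible.isGenericPoint_genericPoint D.isClosed⟩
  have hηS : η ∈ E.sing := hD.subset_sing hη.mem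
  unfold pointInvariant
  rw [Prod.Lex.toLex_lt_toLex]
  by_cases hdiv : Order.coheight η = 1
  · -- divisorial step: measure unchanged, order drops
    exact Or.inr ⟨looseGermMeasure_curveStep_eq A A' E hdimZ hD hη hdiv hπ y',
      idealOrder_transform_lt_of_divisorialCentre A A' E hE hD hη hdiv hπ hy⟩
  · -- point step on a surface
    have hcl : IsClosed ({η} : Set A.Z) := by
      by_contra hncl
      exact hdiv (coheight_eq_one_of_not_isClosed A hE hdimZ hD hη hncl)
    have h2 : ringKrullDim (A.Z.presheaf.stalk η) = 2 := by
      by_contra h2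
      exact hdiv (coheight_eq_one_of_isClosed_of_ne_two A hE hdimZ hηS h2)
    have hDeq : (D : Set A.Z) = {η} := hη.def.symm.trans hcl.closure_eq
    have hnp' : ∀ ζ ∈ E.sing, ζ ⤳ η → ζ = η := by
      intro ζ hζS hsp
      by_contra hne
      exact hnp ⟨η, ζ, hDeq, hζS, hne, hsp⟩
    have hD' : D = ⟨{η}, hcl⟩ := Closeds.ext hDeq
    subst hD'
    have hyη : π y' = η := by simpa using hy
    refine Or.inl ?_
    rw [hyη]
    exact looseGermMeasure_lt_of_pointCentre A A' E hcl hηS hnp' h2 hπ hyη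

/-- [OURS · L1 W4.6 rung (i-d)] NOT a statement of the manuscript. **RUNG (i-d) HOLDS**: OUR per-point invariant obeys the
Eq. (127)-role over the centre and the Eq. (128)-role off it at every non-procrastinating §2.1-permissible step between
states of dimension `≤ 2`, for every field `K : Type` of characteristic `p`. [folklore] -/
theorem planeInvariantDecreases_holds (p : ℕ) [Fact p.Prime] (K : Type) [Field K] [CharP K p] :
    PlaneInvariantDecreases p K :=
  fun A A' E hE hdim _ hD hnp _ hπ =>
    ⟨fun _ hy => pointInvariant_lt_of_mem A A' E hE hdim hD hnp hπ hy,
      fun _ hy => pointInvariant_eq_of_not_mem E hπ hy⟩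

/-! ## Typed corollary: ∇-steps of notion instances isolating no stray point -/

variable {n : ℕ} {N : Notions.{0} n} {Rd : Reading p K N}

/-- [OURS · L1 W4.6 rung (i-d), typed] NOT a statement of the manuscript. For EVERY notion instance `N` and reading `Rd`
whose résumés never isolate a point of a singular curve (`Resumes.NoStrayPoint N Rd`): at every ∇-step `s` of the typed
Th. 16.6 procedure out of a surface state `(A, E, R)` read by `Rd` (centre a component of the terminal plat `∇(E)`),
OUR invariant satisfies the (127)-role `ι(A′, E′, y′) <_lex ι(A, E, π y′)` at every point over the centre and the
(128)-role `ι(A′, E′, y′) = ι(A, E, π y′)` off it. The résumés' content used: `E` standard (`Resume.mti_isStandard`),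
the centre is §2.1-permissible (`IsCentre.isPermissibleCentre`, Def. 15.12 inclusions) and a singleton component is no
stray point (`hN`). [folklore] -/
theorem StepNabla.pointInvariant_laws (hN : Resumes.NoStrayPoint N Rd) {A : AmbientDatum p K}
    {E : IdealExponent A.Z} (R : Resume N A E) (hRd : Rd A E R) (hdim : Regime.dimLE 2 A E)
    {A' : AmbientDatum p K} (s : StepNabla R A') :
    (∀ y' : A'.Z, s.π y' ∈ (s.D : Set A.Z) →
        pointInvariant A' s.toStep.E' y' < pointInvariant A E (s.π y')) ∧
      (∀ y' : A'.Z, s.π y' ∉ (s.D : Set A.Z) → pointInvariant A' s.toStep.E' y' = pointInvariant A E (s.π y')) := by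
  have hnp : ¬ CentreProcrastinates E s.D := by
    rintro ⟨ξ, η, hD, hηS, hne, hsp⟩
    exact hne (hN A E R hRd hdim s.D s.component ξ hD η hηS hsp)
  exact planeInvariantDecreases_holds p K A A' E R.mti_isStandard.1 hdim s.D s.centre.isPermissibleCentre hnp s.π
    s.blowup

end Laws

end CampaignW46

end Summit.ResolutionOfSingularities.ResolutionOfSingularities.Theorems

end
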